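import Summits.HodgeConjecture.HodgeConjecture.Theorems.VHCAbelianSchemesRoadTracePushforwardCompatOfInstances
import Summits.HodgeConjecture.HodgeConjecture.Theorems.VHCAbelianSchemesRoadHomComplexBoundedVB
import Summits.Ventures.HSemireg.DerivedDescentComp
import Summits.Ventures.HSemireg.HomFunctorPushforwardIso
import Literature.AlgebraicGeometry.Modules.SheafHomFlasque
import Literature.AlgebraicGeometry.Modules.PushforwardAcyclicResolution
import Mathlib.CategoryTheory.ObjectProperty.FiniteProducts
import HarnessLib

/-!
# Road №4 (`VHCAbelianSchemesRoad`) — (Tr)Pair of THEOREM T′ (crux stmt-HodgeConjecture-26512): the comparison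
# `κ• : 𝓗om•(K, –) ⋙ g_*• ⟶ g_*• ⋙ 𝓗om•(g_*•K, –)` is a SHIFT-COMPATIBLE natural transformation; `g_*`-acyclicity of `𝓗om•(K•, I•)`

research route conditional on HC_CM; not a corollary; Q11.4-sentence-2 already refuted in dim ≥ 3.

Seat core-w1 ((TrPair) owner; director-hodge g16 R16.21 (1) «(N3′) ⟸ route K naturality»). `--supports stmt-HodgeConjecture-26512
--as helper`; closes NO stub or item; nothing here says (Tr)Pair, (SC), (c1), THEOREM T′, `HC_AV`, `HC_CM` or HC holds; HC_CM HELD,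
by name only. This file is the toolbox of the (N3′) proof (`VHCAbelianSchemesRoadTracePhiCompatOfRouteK.lean`, next file):

* §1 `shiftedHomMap_map_Q` — **`Φ_*([w̃]) = [Φ w̃]`**: the venture's descended functor `shiftedHomMap Φ` sends the class of a chain map
  `w̃ : K ⟶ L⟦n⟧` to the class of `Φ w̃` (the factorisation `Q ⋙ derivedLift Φ ≅ Φ ⋙ Q` commutes with the shifts, venture
  `DerivedDescentComp` ∕ Mathlib `NatTrans.commShift_iso_hom_of_localization`); `shiftedHomMap_comp_shift_map_Q` —
  `Φ_*(x ≫ (Q φ)⟦n⟧') = Φ_*(x) ≫ (Q (Φ φ))⟦n⟧'`; two bookkeeping identities for `ShiftedHom.map`.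
* §2 **the terms of `𝓗om•(K•, I•)` are `g_*`-acyclic** for `K•` a bounded complex of vector bundles and `I•` termwise injective:
  `𝓗om(K^i, I^j)` is FLASQUE (the tree's `isFlasque_sheafHom`, Godement II Thm. 3.1.2, with `isFlasque_of_injective_modules`), hence
  acyclic on every open, and `g_*`-acyclicity is closed under finitely supported coproducts (`acyclicClass_pushforward` + Mathlib
  `ObjectProperty.IsClosedUnderFiniteProducts`).
* §3 **`kappaNatTrans A g K a b : 𝓗om•(K, –) ⋙ g_*• ⟶ g_*• ⋙ 𝓗om•(g_*•K, –)`** (components core-w1's `kappaData =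
  homComplexPushforwardComparison`, naturality p653722) and the THEOREM **`kappaNatTrans_commShift : NatTrans.CommShift (kappaNatTrans …) ℤ`** (a `Prop`; use with `haveI`) — summand by summand every
  shift isomorphism (`BifunctorShift` on `𝓗om•(K, –)`, `Functor.commShiftMapCochainComplex` on `g_*•`) is an identity; the template is
  core-SC's `homFunctorPushforwardIso_hom_commShift` (scheme isomorphisms), here for the non-invertible comparison along an isogeny.

Everything is proved; no named fact; no `sorry`. [cite: Weibel1994, §1.2 (1.2.6), 2.7.4–2.7.5, §10.4 and Cor. 10.4.7]
[cite: Hartshorne1977, III Prop. 1.2A, III Prop. 6.7 (proof), III Prop. 8.1] [cite: StacksProject, Tag 01CM].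
-/

noncomputable section

-- `TopCat.Presheaf`/`Scheme.Modules`/`GradedObject` are not reducible (as in Mathlib's `AlgebraicGeometry/Modules/Sheaf.lean`).
set_option backward.isDefEq.respectTransparency false

open CategoryTheory CategoryTheory.Category CategoryTheory.Limits AlgebraicGeometry Opposite
open DerivedCategory

namespace Summit.HodgeConjecture.HodgeConjecture.Ring2.SemiregularRepresentatives

set_option linter.dupNamespace false -- the cell's namespace repeats the summit name, as in every `Ring2*` file

open Literature.AlgebraicGeometry Literature.AlgebraicGeometry.Modules Literature.AlgebraicGeometry.Motives
open Literature.AlgebraicGeometry.Motives.AbelianVariety Literature.AlgebraicGeometry.KTheory Literature.Algebra.Homology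
open Summit.Ventures.HSemireg Summit.Ventures.HSemireg.HomComplex

/-! ## §1 `shiftedHomMap` on classes of chain maps, and on composites with `Q` of a chain map -/

section Generic

universe w' v' u'

variable {C : Type u'} [Category.{v'} C] [Abelian C] [HasDerivedCategory.{w'} C]
  (Φ : CochainComplex C ℤ ⥤ CochainComplex C ℤ) [Φ.CommShift ℤ]
  (hΦ : (HomologicalComplex.quasiIso C (ComplexShape.up ℤ)).IsInvertedBy (Φ ⋙ DerivedCategory.Q))

/-- **`Φ_*([w̃]) = [Φ w̃]`**: the descended functor applied to the class `w̃.map Q : Q K ⟶ (Q L)⟦n⟧` of a chain map `w̃ : K ⟶ L⟦n⟧` is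
the class of `w̃.map Φ` — the factorisation `Q ⋙ derivedLift Φ ≅ Φ ⋙ Q` commutes with the shifts (venture `DerivedDescentComp`,
Mathlib `NatTrans.commShift_iso_hom_of_localization` and `ShiftedHom.map_naturality_1`).
[cite: Weibel1994, Def. 10.3.1 and Cor. 10.4.7 (localisation at quasi-isomorphisms)] -/
theorem shiftedHomMap_map_Q {K L : CochainComplex C ℤ} {n : ℤ} (w : ShiftedHom K L n) :
    shiftedHomMap Φ hΦ (w.map DerivedCategory.Q) = (w.map Φ).map DerivedCategory.Q := by
  have h := ShiftedHom.map_naturality_1 w (derivedLiftFac Φ hΦ)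
  rw [ShiftedHom.comp_map, ShiftedHom.comp_map, ShiftedHom.comp_mk₀, ShiftedHom.mk₀_comp] at h
  rw [shiftedHomMap_eq]
  exact h

/-- **`Φ_*(x ≫ (Q φ)⟦n⟧') = Φ_*(x) ≫ (Q (Φ φ))⟦n⟧'`** for a derived class `x` and a chain map `φ` (naturality of the factorisation
isomorphism and of the shift-commutation of `derivedLift Φ`). [cite: Weibel1994, Def. 10.3.1 and Cor. 10.4.7] -/
theorem shiftedHomMap_comp_shift_map_Q {K L L' : CochainComplex C ℤ} {n : ℤ}
    (x : ShiftedHom (DerivedCategory.Q.obj K) (DerivedCategory.Q.obj L) n) (φ : L ⟶ L') :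
    shiftedHomMap Φ hΦ (x ≫ (DerivedCategory.Q.map φ)⟦n⟧' :
        ShiftedHom (DerivedCategory.Q.obj K) (DerivedCategory.Q.obj L') n) =
      shiftedHomMap Φ hΦ x ≫ (DerivedCategory.Q.map (Φ.map φ))⟦n⟧' := by
  simp only [shiftedHomMap_eq, ShiftedHom.map, Functor.map_comp, assoc]
  rw [Functor.commShiftIso_hom_naturality_assoc, ← Functor.map_comp, ← Functor.map_comp]
  have hnat : (derivedLift Φ hΦ).map (DerivedCategory.Q.map φ) ≫ (derivedLiftFac Φ hΦ).hom.app L' =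
      (derivedLiftFac Φ hΦ).hom.app L ≫ DerivedCategory.Q.map (Φ.map φ) :=
    (derivedLiftFac Φ hΦ).hom.naturality φ
  rw [hnat]

omit [Abelian C] [HasDerivedCategory C] in
/-- `(x ≫ φ⟦n⟧').map F = x.map F ≫ (F φ)⟦n⟧'` for a functor `F` commuting with the shifts. [folklore] -/
theorem shiftedHom_map_comp_shift_map {D : Type*} [Category D] [HasShift D ℤ] [HasShift C ℤ] {X Y Y' : C} {n : ℤ}
    (x : ShiftedHom X Y n) (φ : Y ⟶ Y') (F : C ⥤ D) [F.CommShift ℤ] :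
    ShiftedHom.map (x ≫ φ⟦n⟧' : ShiftedHom X Y' n) F = x.map F ≫ (F.map φ)⟦n⟧' := by
  simp only [ShiftedHom.map, Functor.map_comp, assoc, Functor.commShiftIso_hom_naturality]

omit [Abelian C] [HasDerivedCategory C] in
/-- `(φ ≫ x).map F = F φ ≫ x.map F` for a functor `F` commuting with the shifts. [folklore] -/
theorem shiftedHom_map_precomp {D : Type*} [Category D] [HasShift D ℤ] [HasShift C ℤ] {X' X Y : C} {n : ℤ}
    (φ : X' ⟶ X) (x : ShiftedHom X Y n) (F : C ⥤ D) [F.CommShift ℤ] :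
    ShiftedHom.map (φ ≫ x : ShiftedHom X' Y n) F = F.map φ ≫ x.map F := by
  simp only [ShiftedHom.map, Functor.map_comp, assoc]

end Generic

/-! ## §2 The terms of `𝓗om•(K•, I•)` are `g_*`-acyclic for `I•` termwise injective -/

section Acyclic

universe u

variable {X Y : Scheme.{u}} (g : X ⟶ Y)

open ZeroObject in
/-- **Finite biproducts of `g_*`-acyclic modules are `g_*`-acyclic** (the `g_*`-acyclic modules form an acyclic class, closed under
isomorphisms and binary biproducts — `acyclicClass_pushforward`; Mathlib `ObjectProperty.IsClosedUnderFiniteProducts.mk'`).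
[cite: Hartshorne1977, III Prop. 1.2A] -/
theorem isPushforwardAcyclic_biproduct {ι : Type} [Finite ι] (G : ι → X.Modules) [HasBiproduct G]
    (hG : ∀ i, IsPushforwardAcyclic g (G i)) : IsPushforwardAcyclic g (⨁ G) := by
  let P : ObjectProperty X.Modules := fun F => IsPushforwardAcyclic g F
  haveI : P.IsClosedUnderIsomorphisms := ⟨fun e hF => (acyclicClass_pushforward g).of_iso e hF⟩
  haveI : P.ContainsZero :=
    ⟨⟨(0 : X.Modules), isZero_zero X.Modules, IsPushforwardAcyclic.of_isZero g (isZero_zero X.Modules)⟩⟩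
  haveI : P.IsClosedUnderBinaryProducts :=
    ObjectProperty.IsClosedUnderLimitsOfShape.mk' (by
      rintro _ ⟨D, hD⟩
      have h : P (D.obj ⟨WalkingPair.left⟩ ⊞ D.obj ⟨WalkingPair.right⟩) :=
        (acyclicClass_pushforward g).biprod (hD _) (hD _)
      exact P.prop_of_iso ((biprod.isoProd _ _) ≪≫ (HasLimit.isoOfNatIso (diagramIsoPair D)).symm) h)
  haveI : P.IsClosedUnderFiniteProducts := ObjectProperty.IsClosedUnderFiniteProducts.mk'
  exact P.prop_of_iso (biproduct.isoProduct G).symm (P.prop_product hG)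

/-- **A coproduct of `g_*`-acyclic modules supported on a finite set is `g_*`-acyclic** (it is the finite biproduct of the members on
the support, core-w2's `sigmaIsoBiproductOfIsZero`). [cite: Hartshorne1977, III Prop. 1.2A] -/
theorem isPushforwardAcyclic_sigmaObj_of_finset {J : Type} (F : J → X.Modules) [HasCoproduct F] (S : Finset J)
    (hS : ∀ j, j ∉ S → IsZero (F j)) (hF : ∀ j, IsPushforwardAcyclic g (F j)) : IsPushforwardAcyclic g (∐ F) := by
  letI : HasFiniteBiproducts X.Modules := HasFiniteBiproducts.of_hasFiniteProducts
  exact (acyclicClass_pushforward g).of_iso (sigmaIsoBiproductOfIsZero F S hS).symm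
    (isPushforwardAcyclic_biproduct g (fun s : S => F s) fun s => hF s.1)

/-- **`𝓗om(E, I)` is `g_*`-acyclic for `E` finite locally free and `I` injective**: it is flasque (the tree's `isFlasque_sheafHom`,
Godement II Thm. 3.1.2, with `isFlasque_of_injective_modules`), hence acyclic on every open (`subsingleton_ext_freeSheaf_of_isFlasque`).
[cite: Hartshorne1977, III Prop. 6.7 (proof) and III.2.5] -/
theorem isPushforwardAcyclic_sheafHom_of_injective {E : X.Modules} (hE : IsFiniteLocallyFree E) (I : X.Modules)
    [Injective I] : IsPushforwardAcyclic g (sheafHom E I) := by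
  haveI := isFlasque_of_injective_modules I
  haveI : TopCat.Sheaf.IsFlasque ((Literature.AlgebraicGeometry.HodgeTheory.modulesToSheaf X).obj (sheafHom E I)) :=
    isFlasque_sheafHom hE I
  exact fun V _ n => IsAcyclicOn.subsingleton_ext_freeSheaf_of_isFlasque (T := X.carrier)
    ((Literature.AlgebraicGeometry.HodgeTheory.modulesToSheaf X).obj (sheafHom E I)) (g ⁻¹ᵁ V) n

/-- **The terms `𝓗om•(K•, I•)^n = ∐_{q+i=n} 𝓗om(K^{-i}, I^q)` are `g_*`-acyclic** for `K•` in `[a, b]` with vector-bundle terms and `I•`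
termwise injective (a coproduct of `g_*`-acyclics supported on `-b ≤ i ≤ -a`). [cite: Hartshorne1977, III Prop. 6.7 (proof) and III Prop. 8.1]
[cite: Weibel1994, 2.7.4–2.7.5 (Hom double complex)] -/
theorem isPushforwardAcyclic_homComplex_X_of_injective (K L : CochainComplex X.Modules ℤ) (a b : ℤ)
    [K.IsStrictlyGE a] [K.IsStrictlyLE b] (hK : ∀ p, IsFiniteLocallyFree (K.X p)) (hL : ∀ p, Injective (L.X p)) (n : ℤ) :
    IsPushforwardAcyclic g (((homFunctor X K).obj L).X n) := by
  classical
  let p := ComplexShape.π (ComplexShape.up ℤ) (ComplexShape.up ℤ) (ComplexShape.up ℤ)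
  change IsPushforwardAcyclic g
    (∐ (Literature.AlgebraicGeometry.HodgeTheory.homBicomplex X K L).toGradedObject.mapObjFun p n)
  refine isPushforwardAcyclic_sigmaObj_of_finset g _
    (((Finset.Icc (-b) (-a)).image fun i : ℤ => (n - i, i)).subtype (· ∈ p ⁻¹' {n})) (fun x hx => ?_) (fun x => ?_)
  · obtain ⟨⟨q, i⟩, hqi⟩ := x
    have hn : q + i = n := hqi
    refine Literature.AlgebraicGeometry.HodgeTheory.isZero_homBicomplex_of_lt_or_lt K L a b q i ?_
    by_contra hcon
    obtain ⟨h1, h2⟩ := not_or.mp hcon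
    rw [not_lt] at h1 h2
    apply hx
    rw [Finset.mem_subtype, Finset.mem_image]
    exact ⟨i, Finset.mem_Icc.mpr ⟨h1, h2⟩, Prod.ext (by change n - i = q; omega) rfl⟩
  · obtain ⟨⟨q, i⟩, hqi⟩ := x
    change IsPushforwardAcyclic g (sheafHom (K.X (-i)) (L.X q))
    haveI := hL q
    exact isPushforwardAcyclic_sheafHom_of_injective g (hK (-i)) (L.X q)

end Acyclic

/-! ## §3 `κ` as a SHIFT-COMPATIBLE natural transformation `𝓗om•(K, –) ⋙ g_*• ⟶ g_*• ⋙ 𝓗om•(g_*•K, –)` -/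

section Kappa

variable (A : AbelianVariety ℂ) (g : A ⟶ A) (K : CochainComplex A.X.left.Modules ℤ)

/-- A morphism out of `g_*(𝓗om•(K, L)^n)` is determined by its compositions with the `g_*(ι_{q,i})` (core-w1's Literature
`pushforward_ι_hom_ext`, retyped on the venture's `homFunctor`; the two copies of `𝓗om•` agree definitionally). [cite: Weibel1994, §1.2, 1.2.6] -/
theorem pushforward_ι_kappa_hom_ext (a b : ℤ) [K.IsStrictlyGE a] [K.IsStrictlyLE b] {L : CochainComplex A.X.left.Modules ℤ} {n : ℤ}
    {T : A.X.left.Modules}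
    {φ ψ : (Scheme.Modules.pushforward (Hom.toSchemeHom g)).obj (((homFunctor A.X.left K).obj L).X n) ⟶ T}
    (h : ∀ (q i : ℤ) (hqi : q + i = n),
      (Scheme.Modules.pushforward (Hom.toSchemeHom g)).map (ι A.X.left K L q i n hqi) ≫ φ =
        (Scheme.Modules.pushforward (Hom.toSchemeHom g)).map (ι A.X.left K L q i n hqi) ≫ ψ) :
    φ = ψ :=
  Literature.AlgebraicGeometry.HodgeTheory.pushforward_ι_hom_ext (Hom.toSchemeHom g) K L a b h

variable (a b : ℤ) [K.IsStrictlyGE a] [K.IsStrictlyLE b]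

/-- **`κ• : 𝓗om•(K, –) ⋙ g_*• ⟶ g_*• ⋙ 𝓗om•(g_*•K, –)` as a natural transformation** of endofunctors of cochain complexes
(components `kappaData`, naturality = core-w1's Literature `homComplexPushforwardComparison_naturality`).
[cite: StacksProject, Tag 01CM (f_*𝓗om(E, L) → 𝓗om(f_*E, f_*L))] [cite: Weibel1994, 2.7.4–2.7.5] -/
def kappaNatTrans :
    homFunctor A.X.left K ⋙ (Scheme.Modules.pushforward (Hom.toSchemeHom g)).mapHomologicalComplex (ComplexShape.up ℤ) ⟶
      (Scheme.Modules.pushforward (Hom.toSchemeHom g)).mapHomologicalComplex (ComplexShape.up ℤ) ⋙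
        homFunctor A.X.left (endoPushforwardComplex A g K) where
  app L := kappaData A g K L a b
  naturality _ _ φ :=
    Literature.AlgebraicGeometry.HodgeTheory.homComplexPushforwardComparison_naturality (Hom.toSchemeHom g) K a b φ

/-- The components of `kappaNatTrans` are `kappaData`. [cite: StacksProject, Tag 01CM] -/
@[simp]
theorem kappaNatTrans_app (L : CochainComplex A.X.left.Modules ℤ) : (kappaNatTrans A g K a b).app L = kappaData A g K L a b := rfl

/-- The summand computation behind the shift compatibility, left-hand side: on the summand `(p, q)` of `𝓗om•(K, L⟦n'⟧)^n` (`p + q = n`,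
object `𝓗om(K^{-q}, L^{p+n'})`), `g_*(ι) ≫ g_*((𝓗om•(K,–)-shift iso)_n) ≫ (g_*•-shift iso)_n ≫ (κ_L⟦n'⟧)_n` is the module-level
comparison followed by `ι'_{p+n', q}` (all shift isomorphisms are identities on summands). [cite: Weibel1994, §1.2, 1.2.6 and §10.4] -/
theorem kappa_shift_comm_summand_lhs (L : CochainComplex A.X.left.Modules ℤ) (n' p q n : ℤ) (hpq : p + q = n) :
    (Scheme.Modules.pushforward (Hom.toSchemeHom g)).map (ι A.X.left K (L⟦n'⟧) p q n hpq) ≫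
        (Scheme.Modules.pushforward (Hom.toSchemeHom g)).map ((((homFunctor A.X.left K).commShiftIso n').hom.app L).f n) ≫
          ((((Scheme.Modules.pushforward (Hom.toSchemeHom g)).mapHomologicalComplex (ComplexShape.up ℤ)).commShiftIso n').hom.app
              ((homFunctor A.X.left K).obj L)).f n ≫
            ((shiftFunctor (HomologicalComplex A.X.left.Modules (ComplexShape.up ℤ)) n').map (kappaData A g K L a b)).f n =
      sheafHomPushforwardComparison (Hom.toSchemeHom g) (K.X (-q)) (L.X (p + n')) ≫
        ι A.X.left (endoPushforwardComplex A g K) (endoPushforwardComplex A g L) (p + n') q (n + n') (by omega) := by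
  rw [Functor.mapHomologicalComplex_commShiftIso_hom_app_f]
  erw [Category.id_comp, CochainComplex.shiftFunctor_map_f']
  rw [← Functor.map_comp_assoc]
  erw [Functor.commShiftIso_map₂CochainComplex_flip_hom_app]
  erw [CochainComplex.ι_mapBifunctorShift₁Iso_hom_f L (dualComplex A.X.left K) (sheafHomBifunctor A.X.left).flip n' p q n hpq
    (p + n') (n + n') rfl rfl]
  simp only [CochainComplex.shiftFunctorObjXIso, HomologicalComplex.XIsoOfEq, eqToIso_refl, Iso.refl_hom,
    Iso.refl_inv, Category.comp_id]
  exact map_ι_comp_kappaData_f A g K L a b (p + n') q (n + n') _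

set_option maxHeartbeats 400000 in
-- the summand-by-summand unfolding of three shift isomorphisms is long (as in core-SC's `shift_comm_summand_rhs`)
/-- The summand computation, right-hand side: `g_*(ι) ≫ (κ_{L⟦n'⟧})_n ≫ 𝓗om•(g_*•K, (g_*•-shift iso))_n ≫ ((𝓗om•(g_*•K,–)-shift iso)_{g_*•L})_n`
is the same morphism. [cite: Weibel1994, §1.2, 1.2.6 and §10.4] -/
theorem kappa_shift_comm_summand_rhs (L : CochainComplex A.X.left.Modules ℤ) (n' p q n : ℤ) (hpq : p + q = n) :
    (Scheme.Modules.pushforward (Hom.toSchemeHom g)).map (ι A.X.left K (L⟦n'⟧) p q n hpq) ≫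
        (kappaData A g K (L⟦n'⟧) a b).f n ≫
          ((homFunctor A.X.left (endoPushforwardComplex A g K)).map
              ((((Scheme.Modules.pushforward (Hom.toSchemeHom g)).mapHomologicalComplex (ComplexShape.up ℤ)).commShiftIso n').hom.app
                L)).f n ≫
            (((homFunctor A.X.left (endoPushforwardComplex A g K)).commShiftIso n').hom.app (endoPushforwardComplex A g L)).f n =
      sheafHomPushforwardComparison (Hom.toSchemeHom g) (K.X (-q)) (L.X (p + n')) ≫
        ι A.X.left (endoPushforwardComplex A g K) (endoPushforwardComplex A g L) (p + n') q (n + n') (by omega) := by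
  have h1 := map_ι_comp_kappaData_f A g K (L⟦n'⟧) a b p q n hpq
  have h2 := ι_map A.X.left (endoPushforwardComplex A g K)
    ((((Scheme.Modules.pushforward (Hom.toSchemeHom g)).mapHomologicalComplex (ComplexShape.up ℤ)).commShiftIso n').hom.app L)
    p q n hpq
  rw [Functor.mapHomologicalComplex_commShiftIso_hom_app_f, sheafHomMap_id] at h2
  erw [Category.id_comp] at h2
  rw [← Category.assoc, h1, Category.assoc, homFunctor_map_f, ← Category.assoc (ι A.X.left _ _ p q n hpq)]
  erw [h2]
  erw [Functor.commShiftIso_map₂CochainComplex_flip_hom_app]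
  erw [CochainComplex.ι_mapBifunctorShift₁Iso_hom_f (endoPushforwardComplex A g L)
    (dualComplex A.X.left (endoPushforwardComplex A g K)) (sheafHomBifunctor A.X.left).flip
    n' p q n hpq (p + n') (n + n') rfl rfl]
  simp only [CochainComplex.shiftFunctorObjXIso, HomologicalComplex.XIsoOfEq, eqToIso_refl, Iso.refl_hom,
    Iso.refl_inv, Category.comp_id]
  rfl

/-- **`κ•` commutes with the shifts** (Mathlib `NatTrans.CommShift`) for the `BifunctorShift` structure on `𝓗om•(K, –)` and
`Functor.commShiftMapCochainComplex` on `g_*•` — all identities summand by summand. [cite: Weibel1994, §10.4] -/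
theorem kappaNatTrans_commShift : NatTrans.CommShift (kappaNatTrans A g K a b) ℤ where
  shift_comm n' := by
    ext L n : 3
    refine pushforward_ι_kappa_hom_ext A g K a b fun p q hpq => ?_
    simp only [NatTrans.comp_app, Functor.whiskerRight_app, Functor.whiskerLeft_app,
      Functor.commShiftIso_comp_hom_app, kappaNatTrans_app, HomologicalComplex.comp_f,
      Functor.mapHomologicalComplex_map_f, Category.assoc]
    rw [kappa_shift_comm_summand_lhs, kappa_shift_comm_summand_rhs]

end Kappa

end Summit.HodgeConjecture.HodgeConjecture.Ring2.SemiregularRepresentatives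

end
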